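import Literature.Probability.Percolation.DecisionTreeTwoConfig
import Mathlib.Algebra.BigOperators.Group.Finset.Powerset
import Mathlib.Data.Fintype.BigOperators
import HarnessLib

/-!
# One-configuration decision trees with flip marks: the antithetic switching lemma

Support file for crux `NoHeavyLowerTail` (item stmt-CriticalPhenomena-4575; the FIBRE-P3⅔ / antithetic line of
prim-l12-p1).  The Literature files `DecisionTreeTwoConfig.lean` / `DecisionTreeThreeConfig.lean`
record Gladkov's swap lemma (N. Gladkov, *Percolation Inequalities and Decision Trees*, arXiv:2408.08457v2, Lemma 3.1 =
Gladkov–Zimin, arXiv:2404.08873, Lemma 4.2): a decision tree that reveals each queried edge in two INDEPENDENT copies and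
decides, before revealing, whether to exchange the two bits, pushes the product law forward to itself.  This file records
the ONE-configuration analogue, which is the form needed for *antithetic* (complementary-copy) arguments, i.e. for
coefficientwise ("fibre") versions of correlation inequalities under the uniform measure: a decision tree reads ONE
configuration `C ⊆ D`, and every node carries a mark `flip : Bool` decided BEFORE the queried bit is revealed; the output
is `C` with all flip-marked queried coordinates toggled.  **The output map is a bijection of `D.powerset`** (equivalently it
preserves the uniform = `p ≡ 1/2` Bernoulli law; for general `p` it does not, since a toggle exchanges `p` and `1 - p`).
All PROVED, no named facts; standard/folklore (the proof is the one-copy case of the argument of [Gladkov2024, Lemma 3.1]: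
along every root path the output determines the input coordinate by coordinate).

* `DTreeF ι` — leaf, or `node e flip c1 c0` (query `e`, toggle it in the output iff `flip`, continue with `c1` if `e ∈ C`
  else `c0`);  `supportF`, `validF` (Boolean: no descendant re-queries an ancestor's edge), `flipSet T C` (the flip-marked
  coordinates met along the path of `C`), `toggle`, `flipT T C = C Δ flipSet T C`;
* `flipT_node_ins` — on the block `C = ins e b R` of a valid node the output is `ins e (xor b flip) (flipT child R)`;
* **`sum_comp_flipT`** — for `T` valid with `supportF T ⊆ D` and every `f` into an additive commutative monoid,
  `Σ_{C ⊆ D} f (flipT T C) = Σ_{C ⊆ D} f C`;  `flipT_subset`, **`flipT_injOn`** (injective on `D.powerset`),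
  `card_image_flipT`;  `certificate_sum_nonpos` — the certificate principle: potentials that are `≤ 0` pointwise on the outputs of
  finitely many valid trees have total sum `≤ 0` (antithetic form of [GladkovZimin2024, §5]).

Typical use (crux `NoHeavyLowerTail`, fibre form of the three- and four-point reverse-Harris rows): "freeze" some clusters
(query their incident edges with `flip = false`), then explore a cluster of the complementary colour avoiding them with
`flip = true`; the resulting map of colourings is injective by `flipT_injOn`, whatever the (adaptive) exploration order.
Not here: weighted versions (only `p e = 1/2` on flipped coordinates would be law-preserving).
-/

noncomputable section

open Classical

namespace Summit.CriticalPhenomena.PercolationContinuityZ3.Theorems.DecisionTreeFlip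

open Finset Literature.Probability.Percolation.DecisionTree

variable {ι : Type*} [DecidableEq ι]

/-! ### Flip-marked one-configuration trees -/

/-- A decision tree reading one configuration: a leaf, or a node querying the coordinate `e`, carrying a mark `flip`
fixed before the bit is revealed (the output toggles `e` iff `flip`), with two children indexed by the revealed bit
(`c1` if `e ∈ C`, `c0` otherwise). [folklore] -/
inductive DTreeF (ι : Type*) : Type _
  | leaf : DTreeF ι
  | node (e : ι) (flip : Bool) (c1 c0 : DTreeF ι) : DTreeF ι

namespace DTreeF

open DTree2

/-- The child followed on the revealed bit `b`. [folklore] -/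
def child (c1 c0 : DTreeF ι) : Bool → DTreeF ι
  | true => c1
  | false => c0

/-- The set of flip-marked coordinates queried along the path followed by `C`. [folklore] -/
def flipSet : DTreeF ι → Finset ι → Finset ι
  | leaf, _ => ∅
  | node e fl c1 c0, C =>
      let S' := if e ∈ C then flipSet c1 C else flipSet c0 C
      if fl then insert e S' else S'

/-- All coordinates queried anywhere in the tree. [folklore] -/
def supportF : DTreeF ι → Finset ι
  | leaf => ∅
  | node e _ c1 c0 => insert e (supportF c1 ∪ supportF c0)

/-- Well-formedness test (Boolean): no descendant of a node re-queries the node's coordinate — a leaf is valid; a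
node is valid when neither child queries the node's coordinate and both children are valid.  (Boolean-valued so that
it is plainly a computable side condition, not a proposition of the theory.) [folklore] -/
def validF : DTreeF ι → Bool
  | leaf => true
  | node e _ c1 c0 => (decide (e ∉ supportF c1) && decide (e ∉ supportF c0)) && (validF c1 && validF c0)

/-- Toggling the coordinates of `S` in `C`: the symmetric difference `C Δ S`, written with `\` and `∪`. [folklore] -/
def toggle (S C : Finset ι) : Finset ι := (C \ S) ∪ (S \ C)

/-- The output of the tree on `C`: `C` with every flip-marked queried coordinate toggled. [folklore] -/
def flipT (T : DTreeF ι) (C : Finset ι) : Finset ι := toggle (flipSet T C) C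

/-! ### Basic facts -/

/-- Membership in a toggle. [folklore] -/
theorem mem_toggle {S C : Finset ι} {i : ι} : i ∈ toggle S C ↔ (i ∈ C ∧ i ∉ S) ∨ (i ∈ S ∧ i ∉ C) := by
  unfold toggle; simp [mem_union, mem_sdiff]

/-- Off `S`, a toggle does nothing. [folklore] -/
theorem mem_toggle_of_not_mem {S C : Finset ι} {i : ι} (hi : i ∉ S) : i ∈ toggle S C ↔ i ∈ C := by
  rw [mem_toggle]; tauto

/-- On `S`, a toggle negates membership. [folklore] -/
theorem mem_toggle_of_mem {S C : Finset ι} {i : ι} (hi : i ∈ S) : i ∈ toggle S C ↔ i ∉ C := by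
  rw [mem_toggle]; tauto

/-- Toggling the empty set is the identity. [folklore] -/
theorem toggle_empty (C : Finset ι) : toggle ∅ C = C := by
  ext i; rw [mem_toggle]; simp

/-- `flipSet` at a node, through `child`. [folklore] -/
theorem flipSet_node (e : ι) (fl : Bool) (c1 c0 : DTreeF ι) (C : Finset ι) :
    flipSet (node e fl c1 c0) C =
      (if fl then insert e (flipSet (child c1 c0 (decide (e ∈ C))) C)
        else flipSet (child c1 c0 (decide (e ∈ C))) C) := by
  by_cases h : e ∈ C <;> simp [flipSet, child, h]

/-- The support of a child lies in the support of the node. [folklore] -/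
theorem supportF_child_subset (e : ι) (fl : Bool) (c1 c0 : DTreeF ι) (b : Bool) :
    supportF (child c1 c0 b) ⊆ supportF (node e fl c1 c0) := by
  intro i hi
  have h : i ∈ supportF c1 ∪ supportF c0 := by
    rw [mem_union]; cases b
    · exact Or.inr hi
    · exact Or.inl hi
  exact mem_insert_of_mem h

/-- A valid node's children are valid and do not query the node's coordinate. [folklore] -/
theorem validF_child {e : ι} {fl : Bool} {c1 c0 : DTreeF ι} (h : validF (node e fl c1 c0) = true) (b : Bool) :
    validF (child c1 c0 b) = true ∧ e ∉ supportF (child c1 c0 b) := by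
  simp only [validF, Bool.and_eq_true, decide_eq_true_eq] at h
  obtain ⟨⟨h1, h0⟩, v1, v0⟩ := h
  cases b
  · exact ⟨v0, h0⟩
  · exact ⟨v1, h1⟩

/-- The flipped set lies in the support. [folklore] -/
theorem flipSet_subset_supportF : ∀ (T : DTreeF ι) (C : Finset ι), flipSet T C ⊆ supportF T
  | leaf, _ => by simp [flipSet]
  | node e fl c1 c0, C => by
      rw [flipSet_node]
      have hsub := supportF_child_subset e fl c1 c0 (decide (e ∈ C))
      have ih : flipSet (child c1 c0 (decide (e ∈ C))) C ⊆ supportF (child c1 c0 (decide (e ∈ C))) := by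
        cases decide (e ∈ C)
        · exact flipSet_subset_supportF c0 C
        · exact flipSet_subset_supportF c1 C
      intro i hi
      split_ifs at hi with ht
      · rcases mem_insert.1 hi with rfl | hi
        · simp [supportF]
        · exact hsub (ih hi)
      · exact hsub (ih hi)

/-- The flipped set depends on the configuration only through the coordinates in the support (decisions are made on
the revealed bits only). [folklore] -/
theorem flipSet_congr : ∀ (T : DTreeF ι) {C C' : Finset ι},
    (∀ i ∈ supportF T, (i ∈ C ↔ i ∈ C')) → flipSet T C = flipSet T C'
  | leaf, _, _, _ => by simp [flipSet]
  | node e fl c1 c0, C, C', h => by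
      have he : e ∈ supportF (node e fl c1 c0) := by simp [supportF]
      have hs1 := supportF_child_subset e fl c1 c0 true
      have hs0 := supportF_child_subset e fl c1 c0 false
      simp only [child] at hs1 hs0
      have i1 := flipSet_congr c1 (fun i hi => h i (hs1 hi))
      have i0 := flipSet_congr c0 (fun i hi => h i (hs0 hi))
      have ee : (e ∈ C) = (e ∈ C') := propext (h e he)
      simp only [flipSet, i1, i0, ee]

/-- The output of a leaf is the input. [folklore] -/
theorem flipT_leaf (C : Finset ι) : flipT (leaf : DTreeF ι) C = C := by
  unfold flipT; simp only [flipSet]; exact toggle_empty C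

/-- On the block `C = ins e b R` (`e ∉ R`) of a valid node querying `e` with mark `fl`, the output is the child's output on
`R` with the bit `xor b fl` put back at `e`. [folklore] -/
theorem flipT_node_ins {e : ι} {fl : Bool} {c1 c0 : DTreeF ι} (hV : validF (node e fl c1 c0) = true) (b : Bool)
    {R : Finset ι} (hR : e ∉ R) :
    flipT (node e fl c1 c0) (ins e b R) = ins e (xor b fl) (flipT (child c1 c0 b) R) := by
  obtain ⟨-, hec⟩ := validF_child hV b
  set c := child c1 c0 b with hc
  have hd : decide (e ∈ ins e b R) = b := by
    cases b <;> simp [mem_ins_self_iff hR]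
  have hS' : flipSet c (ins e b R) = flipSet c R :=
    flipSet_congr c (fun i hi => mem_ins_of_ne (fun h => hec (h ▸ hi)))
  have heS' : e ∉ flipSet c R := fun h => hec (flipSet_subset_supportF c R h)
  have hfs : flipSet (node e fl c1 c0) (ins e b R) =
      if fl then insert e (flipSet c R) else flipSet c R := by
    rw [flipSet_node, hd, ← hc, hS']
  unfold flipT
  rw [hfs]
  ext i
  by_cases hie : i = e
  · subst hie
    cases fl
    · simp only [Bool.false_eq_true, if_false, Bool.xor_false]
      rw [mem_toggle_of_not_mem heS', mem_ins_self_iff hR, mem_ins_self_iff]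
      unfold toggle; simp [heS', hR]
    · simp only [if_true, Bool.xor_true]
      rw [mem_toggle_of_mem (mem_insert_self _ _), mem_ins_self_iff hR, mem_ins_self_iff]
      · cases b <;> simp
      · unfold toggle; simp [heS', hR]
  · have hi1 : i ∈ (if fl then insert e (flipSet c R) else flipSet c R) ↔ i ∈ flipSet c R := by
      cases fl
      · simp
      · simp [hie]
    rw [mem_ins_of_ne hie]
    by_cases hiS : i ∈ flipSet c R
    · rw [mem_toggle_of_mem (hi1.2 hiS), mem_ins_of_ne hie]
      unfold toggle; simp [mem_sdiff, hiS]
    · rw [mem_toggle_of_not_mem (fun h => hiS (hi1.1 h)), mem_ins_of_ne hie]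
      unfold toggle; simp [mem_sdiff, hiS]

omit [DecidableEq ι] in
/-- The two children satisfy a property as soon as each does. [folklore] -/
theorem forall_child {P : DTreeF ι → Prop} {c1 c0 : DTreeF ι} (h1 : P c1) (h0 : P c0) (b : Bool) :
    P (child c1 c0 b) := by
  cases b
  · exact h0
  · exact h1

/-! ### The antithetic switching lemma: the output map preserves the uniform law -/

/-- **Antithetic switching lemma (one-configuration flip form of Gladkov's Lemma 3.1).**  For a valid flip-marked tree
`T` querying coordinates of `D` and every `f` with values in an additive commutative monoid,
`Σ_{C ⊆ D} f (flipT T C) = Σ_{C ⊆ D} f C`: the output configuration is again uniformly distributed on `D.powerset`,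
whatever the adaptive query order and the (pre-committed) flip marks. [folklore] -/
theorem sum_comp_flipT {β : Type*} [AddCommMonoid β] (T : DTreeF ι) (hV : validF T = true) (D : Finset ι)
    (hD : supportF T ⊆ D) (f : Finset ι → β) :
    ∑ C ∈ D.powerset, f (flipT T C) = ∑ C ∈ D.powerset, f C := by
  induction T generalizing D f with
  | leaf => simp only [flipT_leaf]
  | node e fl c1 c0 ih1 ih0 =>
      have he : e ∈ D := hD (by simp [supportF])
      rw [sum_powerset_split D he, sum_powerset_split D he]
      have hblock : ∀ b : Bool,
          ∑ R ∈ (D.erase e).powerset, f (flipT (node e fl c1 c0) (ins e b R)) =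
            ∑ R ∈ (D.erase e).powerset, f (ins e (xor b fl) R) := by
        intro b
        obtain ⟨hvc, hec⟩ := validF_child hV b
        have hDc : supportF (child c1 c0 b) ⊆ D.erase e := by
          intro i hi
          exact mem_erase.2 ⟨fun h => hec (h ▸ hi), hD (supportF_child_subset e fl c1 c0 b hi)⟩
        have ih : ∀ g : Finset ι → β,
            ∑ R ∈ (D.erase e).powerset, g (flipT (child c1 c0 b) R) = ∑ R ∈ (D.erase e).powerset, g R :=
          fun g => forall_child (P := fun T => validF T = true → supportF T ⊆ D.erase e → ∀ g : Finset ι → β,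
              ∑ R ∈ (D.erase e).powerset, g (flipT T R) = ∑ R ∈ (D.erase e).powerset, g R)
            (fun hv hd => ih1 hv (D.erase e) hd) (fun hv hd => ih0 hv (D.erase e) hd) b hvc hDc g
        rw [← ih (fun R => f (ins e (xor b fl) R))]
        refine sum_congr rfl fun R hR => ?_
        rw [mem_powerset] at hR
        have heR : e ∉ R := fun h => (mem_erase.1 (hR h)).1 rfl
        rw [flipT_node_ins hV b heR]
      simp only [hblock]
      cases fl
      · simp only [Bool.xor_false]
      · simp only [Bool.xor_true, Fintype.sum_bool, Bool.not_true, Bool.not_false]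
        rw [add_comm]

/-- The output of a valid tree querying coordinates of `D` maps `D.powerset` into itself. [folklore] -/
theorem flipT_subset {T : DTreeF ι} {D C : Finset ι} (hD : supportF T ⊆ D) (hC : C ⊆ D) : flipT T C ⊆ D := by
  intro i hi
  unfold flipT at hi
  rcases mem_toggle.1 hi with ⟨hiC, -⟩ | ⟨hiS, -⟩
  · exact hC hiC
  · exact hD (flipSet_subset_supportF T C hiS)

/-- **The output map of a valid flip-marked tree is injective on `D.powerset`** (hence a bijection of it): the number of
configurations `C ⊆ D` with a given output `y ⊆ D` is `1` by `sum_comp_flipT` applied to the indicator of `{y}`.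
[folklore] -/
theorem flipT_injOn {T : DTreeF ι} (hV : validF T = true) {D : Finset ι} (hD : supportF T ⊆ D) :
    Set.InjOn (flipT T) (↑D.powerset : Set (Finset ι)) := by
  intro C₁ h₁ C₂ h₂ heq
  rw [mem_coe] at h₁ h₂
  by_contra hne
  have key := sum_comp_flipT T hV D hD (fun C => if C = flipT T C₁ then (1 : ℕ) else 0)
  rw [sum_ite_eq' D.powerset (flipT T C₁) (fun _ => (1 : ℕ)),
    if_pos (mem_powerset.2 (flipT_subset hD (mem_powerset.1 h₁)))] at key
  rw [sum_boole] at key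
  have htwo : 1 < (D.powerset.filter fun C => flipT T C = flipT T C₁).card := by
    refine one_lt_card.2 ⟨C₁, ?_, C₂, ?_, hne⟩
    · exact mem_filter.2 ⟨h₁, rfl⟩
    · exact mem_filter.2 ⟨h₂, heq.symm⟩
  simp only [Nat.cast_id] at key
  omega

/-- The image of `D.powerset` under the output map of a valid tree has full size `2 ^ |D|`. [folklore] -/
theorem card_image_flipT {T : DTreeF ι} (hV : validF T = true) {D : Finset ι} (hD : supportF T ⊆ D) :
    (D.powerset.image (flipT T)).card = 2 ^ D.card := by
  rw [card_image_of_injOn (flipT_injOn hV hD), card_powerset]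

/-- The output map of a valid tree is a surjection of `D.powerset` onto itself: every `y ⊆ D` is the output of exactly
one input (existence part). [folklore] -/
theorem flipT_surjOn {T : DTreeF ι} (hV : validF T = true) {D : Finset ι} (hD : supportF T ⊆ D) :
    Set.SurjOn (flipT T) (↑D.powerset : Set (Finset ι)) (↑D.powerset : Set (Finset ι)) := by
  have hmaps : Set.MapsTo (flipT T) (↑D.powerset : Set (Finset ι)) (↑D.powerset : Set (Finset ι)) := by
    intro C hC
    rw [mem_coe, mem_powerset] at hC ⊢
    exact flipT_subset hD hC
  exact Finset.surjOn_of_injOn_of_card_le _ hmaps (flipT_injOn hV hD) le_rfl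

/-! ### The certificate principle for flip-marked trees -/

/-- **Certificate principle (antithetic form of the Gladkov–Zimin certificate method).**  Let finitely many valid flip-marked trees
`T k` (`k ∈ Ps`) query coordinates of `D`, and let `lam0`, `lam k` be real potentials on configurations.  If POINTWISE on `D.powerset`
`lam0 C + Σ_k lam k (flipT (T k) C) ≤ 0`, then `Σ_{C ⊆ D} (lam0 C + Σ_k lam k C) ≤ 0` — each output `flipT (T k) C` is again uniform
(`sum_comp_flipT`), so the potentials may be evaluated on the outputs instead of the inputs.  This is the form in which a finite dictionary
of exploration programs with type-potentials certifies a linear inequality between configuration counts (e.g. the fibre rows of the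
reverse-Harris inequalities). [folklore] -/
theorem certificate_sum_nonpos {κ : Type*} (Ps : Finset κ) (T : κ → DTreeF ι) (D : Finset ι)
    (hV : ∀ k ∈ Ps, validF (T k) = true) (hD : ∀ k ∈ Ps, supportF (T k) ⊆ D)
    (lam0 : Finset ι → ℝ) (lam : κ → Finset ι → ℝ)
    (hpt : ∀ C ∈ D.powerset, lam0 C + ∑ k ∈ Ps, lam k (flipT (T k) C) ≤ 0) :
    ∑ C ∈ D.powerset, (lam0 C + ∑ k ∈ Ps, lam k C) ≤ 0 := by
  have hswap : ∑ C ∈ D.powerset, ∑ k ∈ Ps, lam k C = ∑ C ∈ D.powerset, ∑ k ∈ Ps, lam k (flipT (T k) C) := by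
    rw [sum_comm, sum_comm (s := D.powerset)]
    refine sum_congr rfl fun k hk => ?_
    exact (sum_comp_flipT (T k) (hV k hk) D (hD k hk) (lam k)).symm
  calc ∑ C ∈ D.powerset, (lam0 C + ∑ k ∈ Ps, lam k C)
      = ∑ C ∈ D.powerset, lam0 C + ∑ C ∈ D.powerset, ∑ k ∈ Ps, lam k C := sum_add_distrib
    _ = ∑ C ∈ D.powerset, lam0 C + ∑ C ∈ D.powerset, ∑ k ∈ Ps, lam k (flipT (T k) C) := by rw [hswap]
    _ = ∑ C ∈ D.powerset, (lam0 C + ∑ k ∈ Ps, lam k (flipT (T k) C)) := sum_add_distrib.symm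
    _ ≤ ∑ C ∈ D.powerset, (0 : ℝ) := sum_le_sum hpt
    _ = 0 := sum_const_zero

/-! ### Transport (pair-potential) certificates

A flow `G C C'` may be attached to the PAIR (input, output) of a measure-preserving bijection `Φ` of `D.powerset` with
inverse `Ψ`: the configuration `C` exchanges `G C (Φ C)` with its image and `G (Ψ C) C` with its preimage, and these
exchanges cancel in the total.  Hence a signed weight `h` has non-negative total as soon as
`h C + Σ_k (G k C (Φ_k C) - G k (Ψ_k C) C) ≥ 0` holds POINTWISE — no featurewise identity is needed, and the flow may depend
on the types of both endpoints of an arc (strictly more expressive than the output-potentials of `certificate_sum_nonpos`,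
which are the special case `G k C C' = lam k C'`). -/

omit [DecidableEq ι] in
/-- Transport identity behind pair potentials: if `Φ` preserves sums over `D.powerset` and `Ψ` is a left inverse of `Φ`
on `D.powerset`, then `Σ_{C ⊆ D} G (Ψ C) C = Σ_{C ⊆ D} G C (Φ C)` (what a configuration receives from its preimage is
what the preimage sends). [folklore] -/
theorem sum_pair_comp_eq {β : Type*} [AddCommMonoid β] (D : Finset ι) (Φ Ψ : Finset ι → Finset ι)
    (hΦ : ∀ f : Finset ι → β, ∑ C ∈ D.powerset, f (Φ C) = ∑ C ∈ D.powerset, f C)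
    (hinv : ∀ C ∈ D.powerset, Ψ (Φ C) = C) (G : Finset ι → Finset ι → β) :
    ∑ C ∈ D.powerset, G (Ψ C) C = ∑ C ∈ D.powerset, G C (Φ C) := by
  have key : ∑ C ∈ D.powerset, G (Ψ (Φ C)) (Φ C) = ∑ C ∈ D.powerset, G (Ψ C) C := hΦ (fun C => G (Ψ C) C)
  rw [← key]
  exact sum_congr rfl fun C hC => by rw [hinv C hC]

/-- **Transport certificate principle** (antithetic form, pair potentials).  Let the valid flip-marked trees `T k`
(`k ∈ Ps`) query coordinates of `D`, let `S k` be left inverses of their output maps on `D.powerset` (e.g. the output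
maps of the inverse exploration programs), let `h` be a real weight and `G k` real flows on (source, target) pairs.  If
POINTWISE on `D.powerset`  `0 ≤ h C + Σ_k (G k C (flipT (T k) C) - G k (S k C) C)`  — every configuration's weight plus
what it pulls from its images minus what its preimages pull from it is non-negative — then `0 ≤ Σ_{C ⊆ D} h C`.  This is the
format of the transport certificates for the fibre rows (FIBRE-P3⅔) of crux `NoHeavyLowerTail`: the pool of cluster-exploration
programs is closed under inverses, so the flow on an arc may depend on the types of BOTH endpoints. [folklore] -/
theorem transport_certificate_nonneg {κ : Type*} (Ps : Finset κ) (T : κ → DTreeF ι) (S : κ → Finset ι → Finset ι)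
    (D : Finset ι) (hV : ∀ k ∈ Ps, validF (T k) = true) (hD : ∀ k ∈ Ps, supportF (T k) ⊆ D)
    (hinv : ∀ k ∈ Ps, ∀ C ∈ D.powerset, S k (flipT (T k) C) = C)
    (h : Finset ι → ℝ) (G : κ → Finset ι → Finset ι → ℝ)
    (hpt : ∀ C ∈ D.powerset, 0 ≤ h C + ∑ k ∈ Ps, (G k C (flipT (T k) C) - G k (S k C) C)) :
    0 ≤ ∑ C ∈ D.powerset, h C := by
  have hk : ∀ k ∈ Ps, ∑ C ∈ D.powerset, (G k C (flipT (T k) C) - G k (S k C) C) = 0 := by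
    intro k hk
    rw [sum_sub_distrib, sub_eq_zero]
    exact (sum_pair_comp_eq D (flipT (T k)) (S k) (fun f => sum_comp_flipT (T k) (hV k hk) D (hD k hk) f)
      (hinv k hk) (G k)).symm
  have htot : ∑ C ∈ D.powerset, ∑ k ∈ Ps, (G k C (flipT (T k) C) - G k (S k C) C) = 0 := by
    rw [sum_comm]
    exact sum_eq_zero hk
  calc (0 : ℝ) ≤ ∑ C ∈ D.powerset, (h C + ∑ k ∈ Ps, (G k C (flipT (T k) C) - G k (S k C) C)) :=
        sum_nonneg hpt
    _ = ∑ C ∈ D.powerset, h C := by rw [sum_add_distrib, htot, add_zero]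

/-- The inverse of a valid tree's output map exists on `D.powerset` (as a function `Finset ι → Finset ι`): a left inverse
`S` with `S (flipT T C) = C` for all `C ⊆ D`, by injectivity (`flipT_injOn`).  So `transport_certificate_nonneg` applies to
ANY finite family of valid trees; in practice `S` is the output map of the inverse exploration program. [folklore] -/
theorem exists_leftInverse_flipT {T : DTreeF ι} (hV : validF T = true) {D : Finset ι} (hD : supportF T ⊆ D) :
    ∃ S : Finset ι → Finset ι, ∀ C ∈ D.powerset, S (flipT T C) = C := by
  refine ⟨Function.invFunOn (flipT T) (D.powerset : Set (Finset ι)), fun C hC => ?_⟩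
  exact (flipT_injOn hV hD).leftInvOn_invFunOn (Finset.mem_coe.2 hC)

end DTreeF

end Summit.CriticalPhenomena.PercolationContinuityZ3.Theorems.DecisionTreeFlip

end
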